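import Summits.QuantumFields.YangMills.Theorems.ConvexGribovBodyNonSimplyConnectedLatticeGapTwistDefs
import Summits.QuantumFields.YangMills.Theorems.ConvexGribovBodyNonSimplyConnectedLatticeGapCentreFourierTraceBound
import Summits.QuantumFields.YangMills.Theorems.ConvexGribovBodyNonSimplyConnectedLatticeGapCentreSplittingOrderTwo
import Summits.QuantumFields.YangMills.Theorems.ConvexGribovBodyNonSimplyConnectedLatticeGapStubCorrPullbackCover
import Summits.QuantumFields.YangMills.Theorems.ConvexGribovBodyNonSimplyConnectedLatticeGapStubUniversalCoverAux1
import Literature.RepresentationTheory.CompactGroups.CompactSemisimpleUniversalCoverProofs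
import Summits.QuantumFields.YangMills.Theorems.BalabanLadderIRRankPurityCofinalDefs
import Summits.QuantumFields.YangMills.Cruxes.IRcof.Lines.pinned_cofinal_bill
import Summits.QuantumFields.YangMills.Theses.BalabanLadder
import Summits.QuantumFields.YangMills.Theorems.BalabanLadderIRcofEquipartitionSeamCodeHook
import Summits.QuantumFields.YangMills.Theorems.BalabanLadderIRcofEquipartitionSeamUnitDefs
import Summits.QuantumFields.YangMills.Theorems.BalabanLadderIRcofEquipartitionSeamKernelDefs
import Summits.QuantumFields.YangMills.Theorems.BalabanLadderIRcofEquipartitionSeamKernelBridges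
import Summits.QuantumFields.YangMills.Theorems.BalabanLadderIRcofEquipartitionSeamMixUnits
import Summits.QuantumFields.YangMills.Theorems.BalabanLadderIRcofEquipartitionSeamBadRare
import Summits.QuantumFields.YangMills.Theorems.BalabanLadderIRcofSchurFejerFiniteCentralKer
import Summits.QuantumFields.YangMills.Theorems.BalabanLadderIRcofEquipartitionSeamSpectralDict
import Summits.QuantumFields.YangMills.Theorems.BalabanLadderIRcofEquipartitionSeamSliceRealisation
import HarnessLib

/-!
# Crux `IRcof` (stmt-QuantumFields-26930), route `BalabanLadder` — LINE `equipartition_seam`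
# (ideator `ym-ir-idea-22` g2 ∕ rev 3 g3 ∕ revs 4–5 g4 ∕ revs 6–7 g5 ∕ rev 8 g6 ∕ rev 9 g7 ∕ rev 10 g8, lens «solvent»; slot = the N_cof binder of `Lines/pinned_cofinal_bill.lean`)

HONEST LABEL.  The Yang–Mills mass gap (Clay) is NOT proved here or anywhere in the tree; `IRcof` / `IR` stand at
0∕1; nothing continuum / OS / Clay is touched; engine memos (E2-Q3, MC) are GUIDANCE.  This file is a CHECKED
SKELETON: `sorry` enters ONLY through the registered `stub_*`; every other declaration is proved.

## The located first lemma (row 39 `BLINDᴷ′` × solvent «reflection positivity / transfer-operator positivity + centre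
## Fourier analysis»)

Row 39 of the IR bench (`RankPurity.BlindAt`, docstring: «clustering-given-multiplet … nothing beyond is located; why it
might fail: species charged under the centre flux SEE the sector») asks why a light 't Hooft flux multiplet of the
`π₁(G) ≠ 1` theory does not spoil clustering of LOCAL GAUGE-INVARIANT species although no order parameter separates the
flux vacua.  The solvent cell that bites is 't Hooft's 1979 trace inequality, LANDED in the tree on another route:

* `Theorems.NonSimplyConnectedLatticeGap.centreFourier_traceBlindness` (p164278, route `ConvexGribovBody`, crux
  stmt-QuantumFields-16405, line `twist-equipartition-blindness`): for a positive semidefinite transfer power `X`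
  commuting with a unitary representation `U` of the finite centre `Γ = ker π`, and a bounded observable `A` commuting
  with `U`, EQUIPARTITION of the twisted traces (`‖tr(U_k X) − tr X‖ ≤ δ·tr X`) forces BLINDNESS of the normalised
  twisted expectations (`‖tr(U_k X A)·tr X − tr(X A)·tr(U_k X)‖ ≤ (2|Γ|+1)‖A‖ δ (tr X)²`): character projectors
  `P_ψ`, `P_ψ X ⪰ 0`, `|tr(P_ψ X A)| ≤ ‖A‖ tr(P_ψ X)`, and equipartition kills every `ψ ≠ 1`.

Read on the symmetric torus `(2S+1)⁴` in a rotated frame (electric slot ↔ magnetic slot by axis exchange, interface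
clause X5), this says: the DIAGONAL sector means of every bounded local gauge-invariant species agree across 't Hooft
flux sectors up to the equipartition defect — «blindness» is not a third wall but a SEAM between
(EQUI) equipartition of the twist sectors (= lightness of ALL fluxes on tori beyond the correlation length, 't Hooft's
confinement criterion, NO order parameter needed) and (PSC) clustering inside one sector.  Neither the IR bench census
(REDUCTION-CENSUS v6.69, rows 38–40) nor the g0 solvent matrix cites crux 16405's line; this file types its transfer to
the N_cof slot in PHYSICAL UNITS on a COFINAL set of couplings (the currency of `IRnscCof`).

## Shape (rev 10: FIVE registered stubs S1, S3ʷ, T, N, S5ᵛ; L and D THEOREMS (landed); S2ᵛ, S3, S4ᵛ, S6, S7 theorems-modulo-stubs; compositions proved)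

Cover datum `DB` = `(G, H, π, ρH, r)` with `H` simply connected compact simple, `π : H →* G` continuous surjective with
finite central non-trivial kernel (it EXISTS for every non-simply-connected compact simple `G`: Weyl, LANDED
`CompactSemisimpleUniversalCover_holds` + `stub_universalCover_of_cover`).  Sectors = interface labellings
`cls S : GaugeConfig 4 (2S+1) H → Option (planes → ker π)` (vocabulary of `…TwistDefs`).

* S1 `stub_struct`      — STRUCT-EXIST of crux 16405 verbatim (shared; open).
* S2ᵛ `splitVanishing_holds` — **THEOREM since rev 5** (`SchurFejer.splitVanishing_text`, landed `…SchurFejerFiniteCentralKer`);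
                          was: (rev 4) SPLIT with VANISHING label noise `e^{−c(β)β} → 0` (any rate): the tree's
                          `TwistSplitWeight π ρH r (c β) β w` with `c : ℝ → ℝ`, `c(β)·β → ∞`.  Crux 16405's SPLIT verbatim
                          (`SplitAll`, rate `e^{−cβ}`; LANDED for `|ker π| = 2`, vector `r`: `centreSplitting_of_kerOrderTwo`)
                          IMPLIES it: `splitVanishing_of_splitAll` (PROVED, §4).  Located constructions for `|ker π| ≥ 3`: §7.
* S3 `equiUnits_holds`  — **THEOREM-modulo-stubs since rev 8** (B1 from S3ʷ `stub_equiWindowV` + N `stub_labelNoiseV` + S2ᵛ); was: NEW, wall-2-lite: twist equipartition at lattice rate 1 and constant 1 on tori `S ≥ S_e(β)`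
                          for all large `β` ('t Hooft criterion beyond the correlation length; `LowerBounds` carried).
* S4ᵛ `eblindUnitsV_holds` — **THEOREM-modulo-stubs since rev 8** (B2 PEELING from S3ʷ + T `stub_vacuumSlackV` + D + N; since rev 9 D =
                          `spectralDictV_holds` is itself a theorem modulo the ONE real lattice stub L; since rev 10 L is the LANDED theorem
                          `SliceKernel.sliceRealisationV_holds`, so D is a theorem outright); was: THE SEAM: equipartition (rate 1) + splitting weights with vanishing noise ⇒ electric blindness
                          at rate 1 with a species constant uniform in `β` (engine landed p164278; operator / multi-slice form
                          LANDED p664144, §5; hook to row 39's token LANDED p666431, §6; residual: defect robustness).  The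
                          noise is consumed AT THRESHOLD (Peierls activity of label defects `≤ z₀(d, |ker π|)` for `β ≥ β_b(c)`);
                          the precision `e^{−(2S+1)}` in the torus size comes from S3, not from the split (rev 4, §2 docstring).
* S5ᵛ `stub_pscUnitsCofV` — wall 1 (purity) per sector, in physical units, on a cofinal set, N_cof constant shape (same
                          vanishing-noise split hypothesis).
* S6 `badRareUnits_holds` — **THEOREM since rev 7** (`BadRare.badRareUnits_text`, landed `…EquipartitionSeamBadRare`: β-tracked torus
                          Peierls, rate 1, constant uniform in `β`, `S_c := 0`); was: bad event at rate ≥ 1 beyond `S_c(β)` (support).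
* S7 `mixUnits_holds`   — **THEOREM since rev 6** (`Mix.mixUnits_text`, landed `…EquipartitionSeamMixUnits`); was: MIX with
                          thresholds and physical rate (routine re-assembly of the LANDED `mix_core`).
* PROVED: `splitVanishing_of_splitAll` (bridge from 16405's SPLIT), `coverGapCofAll_of` (application; and
  `coverGapCofAll_of_splitAll` with 16405's SPLIT in place of S2ᵛ), `irnscCof_of_coverGapCofAll` (cover transport: Weyl cover + faithful
  `ρH` from `IsCompactSimpleLieGroup H` + the LANDED pullback identity `stub_corrPullbackCover`), `irnscCof_of_stubs`,
  and the slot composition `IRcof_of_stubs : …Theses.BalabanLadder.IRcof` through `PinnedCofinalBill.IRcof_of`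
  (PXcof side = the lead's `stub_pinnedExitsCofinal`, untouched).  Sanity: the unit predicates imply the tree's
  per-β `TwistEquiAt` / `TwistEBlindAt` / `TwistBadRareAt`.

## §6 (rev 3 g3; LANDED p666431 by the custody LEAD ym-ir-line-ab-p1 g7, rev 4 cites BY NAME): typed hook to row 39's
## literal token (`RankPurity.BlindAt` ∕ `FluxCodeBlindness.LightCodeModel`)

Row 39's served currency is the light-code MODEL: sector vacua `e k`, `T (e k) = θ_k • e k`, and for species `A∘` the
DIAGONAL code clause `|⟪e k, A∘ (e l)⟫ − (if k = l then ⟪e 0, A∘ (e 0)⟫ θ_k^w else 0)| ≤ εc`.  §6 =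
`Theorems/BalabanLadderIRcofEquipartitionSeamCodeHook.lean` (ns `…Theorems.NonSimplyConnectedLatticeGap`, imported, in
scope by `open`) proves, sorry-free and at the same `Matrix n n ℂ` level as the engine, the two facts that turn the
engine's currency (normalised SECTOR MEANS `tr(P_ψ 𝕋^w K)/tr(P_ψ 𝕋^w)`) into the model's currency (VACUUM MATRIX
ELEMENTS `⟨Ω_ψ, K Ω_ψ⟩`):
* `Literature.MathematicalPhysics.QuantumLattice.norm_star_dotProduct_mulVec_le` (tree, `TraceInequalitiesProofs`; rev 3's
  `quadForm_of_l2OpNorm` restated it and was replaced by that name at landing) — every matrix has numerical radius `≤ ‖K‖`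
  (ℓ²-operator norm), so the engine needs NO hypothesis on the observable (`centreFourier_traceBlindness_opNorm`,
  `norm_trace_mul_le_opNorm`); slab operators of multi-slice species qualify;
* `posSemidef_sub_eigenProj` + `norm_trace_mul_sub_eigen_le` (+ `_opNorm`, `eigen_le_trace_re`) — RANK-ONE DEFLATION: `B ⪰ 0`, `B e = θ e`, `⟨e,e⟩ = 1`
  ⇒ `‖tr(B K) − θ ⟨e, K e⟩‖ ≤ a · (Re tr B − θ)`; with `B = P_ψ 𝕋^w`, `e = Ω_ψ`, `θ = θ_ψ^w` the error is EXACTLY the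
  sector's cold-pressure excess `Σ_{j≥1} λ_{ψ,j}^w` (the `secExcess` ∕ `LightMultipletPressureAt` quantity of row 39).
Hence: diagonal code clause ⟸ EQUI (S3, via the engine) + per-sector cold pressure (wall 1 currency) + the
lattice↔transfer dictionary (S4's frame rotation X5 — a lattice identity, not a matrix fact).  The off-diagonal clause
(`k ≠ l`) is flux conservation modulo bad configurations (S6).  This is the precise sense in which the seam REPLACES
row 39's «why it might fail: charged species SEE the sector» by 't Hooft's order-parameter-free criterion.

## rev 10 (g8, after LEAD ab-p1 g8 landed the slice-kernel package H2 F1–F7 `…EquipartitionSeamSliceKernel{Algebra,Package,Chain,Assemble,Seam,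
## ZPackage,SecW,SeamTransport}` p698320 ∕ p698405 ∕ p698671 ∕ p698724 ∕ p698953 ∕ p699751 ∕ p700677 ∕ p700904 (= `Lines/equipartition_seam_SliceKernel.lean`
## rev 9 148dcb46cebb §2–§13, crit-3 g6 GATE CLEAN l.1808 ∕ l.1820), the bridge `…SpectralDictRealPosType` p699935, and the four helper files `…EquipartitionSeamSliceKernelBlockKernel` p702331 ∕
## `…SliceKernelBlockCore` p702622 ∕ `…SliceKernelBlockChain` p702705 ∕ `…EquipartitionSeamSliceRealisation` p703079 (LEAD ab-p1 g8, bus l.1840)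
## = `Lines/equipartition_seam_SliceRealisation.lean` rev 1 0079346b2e66 PARTs 1–4 , crit-3 g6 TYPEREAD CLEAN + CERTIFIED l.1835):
## THE LOCATED STUB L IS A THEOREM — `stub_sliceRealisationV` is REPLACED BY NAME by the landed `SliceKernel.sliceRealisationV_holds :
## SpectralDict.SliceRealisationV` (witnesses: one time slice `X = FinSpatialSite (2S+1)³ × Fin 3 → H`, `μ = ⊗Haar`, `K = sandKernel Prod.fst shift w √magW`
## = the gauge-averaged slice kernel sandwiched by the square root of the magnetic slice weight, `T e = ctwist (elTwist π e⁻¹)`; (Z) =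
## `zPackage_of_twistSplitWeight` + `SpectralDict.complexPosType_of_real`; (W) = `blockKernel` of the species in the block layout along the cyclic
## relabelling `relabel`, `abs_blockKernel_le_pathK`, `secW_withEl_eq_blockChain_of` = seam transport (a) + Stage A layers-out (b) + Fubini∕`finSplit` +
## `block_inner` (c) + `(finRotate (M+3)).symm` re-indexing (d)).  Hence `spectralDictV_holds` (D) is a theorem OUTRIGHT and `eblindUnitsV_holds` (S4ᵛ)
## is a theorem modulo S3ʷ + T + N only.  Stubs FIVE = S1, S3ʷ, T, N, S5ᵛ; `coverGapCofAll_of` ∕ `irnscCof_of_stubs` ∕ `IRcof_of_stubs` BYTE-UNCHANGED.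
## HONEST: L was finite-box Fubini∕Haar bookkeeping (the transfer-operator REALISATION of the split-weight sector functions) — its proof adds
## NO width toward `IRcof` and NO mechanism; the located-heavy content of the line is untouched (S3ʷ 't Hooft window, T vacuum slack, N label
## noise, S5ᵛ PSC in units, S1 structure); `IRcof` ∕ `IR` 0∕1; Clay NOT proved.
## rev 9 (g7, after LEAD ab-p1 g8 landed `…EquipartitionSeamSpectralDictJoint` p693769 ∕ `…Trace` p694553 ∕ `…KernelCalc` p694920 ∕ `…Clauses` p696009 ∕
## `…SpectralDict` p696729 = the text of `Lines/equipartition_seam_SpectralDict.lean` rev 1 2e444f4e44a5 PARTs 1–5 (L with the COMPLEX positive-type clause;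
## the real → complex bridge is the separate helper `…SpectralDictRealPosType` p699935), crit-3 TYPEREAD CLEAN l.1726 ∕ l.1736 ∕ correction l.1796 ∕ l.1800;
## stub swap = LEAD L4 ∕ crit-3):
## D `SpectralDictV` DISCHARGED modulo ONE LOCATED REAL LATTICE STUB L `SpectralDict.SliceRealisationV` (slice realisation: for the electric family
## `withEl π z₀ e` of a `TwistSplitWeight` theory on the box `(2S+1)³ × s`, a probability space `(X, μ)`, a bounded symmetric jointly measurable
## positive-type kernel `K` with a measure-preserving `K`-invariant `(ker π)³`-action `T` such that `secZ … (M+2)` is the `T e`-twisted cyclic trace of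
## `K^{M+2}` and every species of temporal thickness `≤` half the extent is a block `Bk` dominated by `nrm A ·` the path kernel) via the landed
## `SpectralDict.spectralDictV_of_sliceRealisationV` (complex-L² joint diagonalisation of the three commuting electric twists with the compact
## self-adjoint kernel operator, twisted trace formula `Literature…TwistedKernelTraceFormula`, species sandwich `Literature…HermitianKernelSandwichedTrace`):
## `spectralDictV_holds := SpectralDict.spectralDictV_of_sliceRealisationV stub_sliceRealisationV`; `eblindUnitsV_holds` feeds it to B2.  L's
## ingredients (all conjuncts but (W) for the concrete slice data: `SliceKernel.zPackage_of_twistSplitWeight`; the torus half of (W):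
## `SliceKernel.secW_withEl_eq_integral_layers`) stand sorry-free in `Lines/equipartition_seam_SliceKernel.lean` rev 8 f6f99d3f5924 (not imported —
## a workfile; landing H2 by LEAD).  Stubs stay SIX = S1, S3ʷ, T, L, N, S5ᵛ (≤ 7); `coverGapCofAll_of` ∕ `irnscCof_of_stubs` ∕ `IRcof_of_stubs`
## BYTE-UNCHANGED.  HONEST: a RE-LINING of D (opaque joint eigen-datum → located Fubini∕slicing statement), NOT a proof of any located claim;
## width toward `IRcof` 0, mechanism 0; `IRcof` ∕ `IR` 0∕1; Clay NOT proved.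
## rev 8 (g6, after `…EquipartitionSeamKernelDefs` p687323 + p687588 (LEAD ab-p1) and pool-p3's `…KernelBridgesPeeling` p688515 + `…KernelBridges` p689323 landed; crit-3 PASS-WITH-PRICE l.1592,
## TYPEREAD CLEAN l.1618 ∕ l.1625 ∕ l.1634 ∕ l.1646): S3 `EquiUnits` and S4ᵛ `EBlindUnitsV` DISCHARGED modulo FOUR LOCATED kernel-currency stubs of the
## split-weight cover theory — S3ʷ `KernelCurrency.EquiWindowV` ('t Hooft equipartition ON THE WINDOW `3(2S+1) ≤ 4s`, FLOOR-FREE; ⊇ S3), T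
## `VacuumSlackV` (thermal slack of the VACUUM trace between extents, LOCATED-HEAVY), D `SpectralDictV` (joint eigen-datum of the three electric
## twists + species coefficients; typing, unproved), N `LabelNoiseV` (interface label classes = canonical sectors up to `e^{−(2S+1)}∕8`, per
## magnetic family, with a species dressing `J`; LOCATED-HEAVY) — via the LANDED bridges B1 `KernelBridges.equiUnits_of_window : EquiWindowV →
## LabelNoiseV → SplitVanishing → EquiUnits` and B2 `KernelBridges.eblindUnitsV_of_peeling : EquiWindowV → VacuumSlackV → SpectralDictV →
## LabelNoiseV → EBlindUnitsV` (PEELING: `ThickSpeciesDatum.eblind_thick_re`, p685489 — a species of temporal thickness `r` sees the sector only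
## through `λ^{2S+1−r}`; with slack T the cross term is `≤ 40·nrm A·C_T·e^{−(2S+2)}·Z·Z′`, uniformly in `β`).  The texts `SplitVanishing` ∕
## `EquiUnits` ∕ `EBlindUnitsV` MOVED verbatim to the defs module (same names ∕ namespace; imported).  Stubs 4 → 6 = S1, S3ʷ, T, D, N, S5ᵛ (≤ 7);
## `coverGapCofAll_of` ∕ `IRcof_of_stubs` BYTE-UNCHANGED; this is a RE-LINING (two opaque stubs → four located ones), NOT progress on any located
## claim: width toward `IRcof` 0, mechanism 0.
## rev 7 (g5, after `…EquipartitionSeamBadRare` landed): S6 `BadRareUnits` DISCHARGED BY NAME (`badRareUnits_holds := BadRare.badRareUnits_text`: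
## the landed torus Peierls bound re-run with `β` kept in the rate — `14406·e^{−c₀β} ≤ e^{−50}` ⇒ mass `≤ C e^{−S}`, ONE `C`); stubs 5 → 4 = S1, S3, S4ᵛ, S5ᵛ.
## rev 6 (drafted g4, published g5 after p676630 U ∕ p676879 M landed): S7 `MixUnits` DISCHARGED BY NAME (`mixUnits_holds := Mix.mixUnits_text`, landed `…EquipartitionSeamMixUnits`:
## crux 16405's per-torus mixture argument above thresholds with β-uniform constants); §0–§1 unit predicates MOVED verbatim to the
## landed `…EquipartitionSeamUnitDefs` (same names ∕ namespace; imported); stubs 6 → 5 = S1, S3, S4ᵛ, S5ᵛ, S6.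
## rev 5 (g4): S2ᵛ `SplitVanishing` DISCHARGED BY NAME (`splitVanishing_holds := SchurFejer.splitVanishing_text`, landed
## `…SchurFejerFiniteCentralKer` ← `…JointAmp` ∕ `…GenerationPi` ∕ `…AmpChar` ∕ `…CyclicKer` ∕ `…Isotypic` ∕ `…TwistChar` ∕ `…SplitVanishing` ∕
## `…SplitWindow` ∕ `…Laplace` ∕ `…Split` ∕ `…Window` ∕ `…Core`, LEAD lane ab-p1 from this line's Schur–Fejér core); stubs 7 → 6.
## rev 4 (g4): (i) §5 ∕ §6 cited BY NAME (p664144, p666431; in-file copies deleted); (ii) the split is consumed with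
## VANISHING noise (S2ᵛ ∕ S4ᵛ ∕ S5ᵛ); (iii) §7 records the two located splitting-weight constructions for `|ker π| ≥ 3`

(ii) answers the critic's question (ym-ir bus 2026-08-28T20:42:21Z, «does EBLIND ∕ PSC downstream survive polynomial
noise?»): YES as this line draws the seam.  In the intended proof of S4 ∕ S5 (crux 16405 card (III): joint `(V, α)`
representation of the EXACT mixture `Π_p Σ_{α_p ∈ ker π} w(α_p V_p)`, `ker π`-gauge `α ≡ 1` off the last time step,
electric coordinate = `ker π`-holonomy of the labels times LOCALISED flip insertions at the DILUTE label defects,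
Fourier inversion on `(ker π)³`, positivity of the transfer operator) the label noise is the ACTIVITY of a label defect
and is used only below a Peierls threshold `z₀(d, |ker π|)`: a wrapping defect structure of linear size `≥ 2S+1` then
has probability `≤ (K z(β))^{2S+1} ≤ e^{−(2S+1)}` once `K z(β) ≤ e^{−1}`, which any noise `→ 0` delivers for `β ≥ β_b`;
the rate `e^{−(2S+1)}` and the `β`-uniform constants of `EBlindUnitOn` come from S3 (twist equipartition at unit rate)
through the engine, whose currency has no `w` at all.  Hence S4ᵛ ∕ S5ᵛ quantify `∀ c : ℝ → ℝ, c(β)·β → ∞` (noise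
`e^{−c(β)β} → 0`) and output thresholds `β_b, S_b(β)` that may depend on `c`; rev 3's S4 ∕ S5 (fixed `c > 0`) are the
special case, and 16405's SPLIT (fixed rate) still feeds the line through `splitVanishing_of_splitAll`.  What is NOT
claimed: that the Peierls step is typed or proved — it is the declared residual of S4ᵛ («defect robustness»), as in rev 3.

Disproof honoured: `IRnscCof_false_without_LowerBounds` (p630186) — every physical-unit stub carries `LowerBounds`;
`HeavyTwist.not_pinnedExitsCofinalFree` (p624174) — no X-free pinning is asserted, the nsc side never uses `ColdExit`;
p605461 (`not_coldExitSimple_of_lightFluxMode_SO3`) — the light flux multiplet is ALLOWED here (it is the point).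
-/

set_option autoImplicit false

noncomputable section

open Filter Topology MeasureTheory
open Literature.MathematicalPhysics.QuantumFieldTheory Literature.MathematicalPhysics.QuantumLattice
open Summit.QuantumFields.YangMills.Cruxes.OSLegsFromFemtoAndGap.DlrCollarTransfer (LowerBounds)
open Summit.QuantumFields.YangMills.Theorems.NonSimplyConnectedLatticeGap
open Summit.QuantumFields.YangMills.Cruxes.IR.RankPurity (IRnscCof)

namespace Summit.QuantumFields.YangMills.Cruxes.IRcof.EquipartitionSeam

/-! ## §0–§1 (rev 6): the abbreviations `Plane`, `Sector`, `Labelling` and the UNIT-CURRENCY predicates `EquiUnitOn`,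
## `EBlindUnitOn`, `PscUnitOn`, `BadUnitOn`, `CoverGapCof` (+ the three sanity lemmas) are LANDED VERBATIM as
## `Theorems/BalabanLadderIRcofEquipartitionSeamUnitDefs.lean` (same namespace, same names) and imported — no copy kept here. -/

/-! ## §2 The line's statements (each universally closed over cover data `DB`) -/

/-- **S1 = STRUCT-EXIST of crux 16405 (shared, open)**: an interface labelling family exists at every cover datum. -/
def StructAll : Prop :=
  ∀ (G : Type) [Group G] [TopologicalSpace G] [IsTopologicalGroup G] [CompactSpace G] [MeasurableSpace G]
    [BorelSpace G], IsCompactSimpleLieGroup G → ∀ (H : Type) [Group H] [TopologicalSpace H] [IsTopologicalGroup H]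
    [CompactSpace H] [MeasurableSpace H] [BorelSpace H], IsCompactSimpleLieGroup H → SimplyConnectedSpace H →
    ∀ (π : H →* G), Continuous π → Function.Surjective π → π.ker ≤ Subgroup.center H → (π.ker : Set H).Finite →
    π.ker ≠ ⊥ → ∀ (ρH : LatticeRep H) (r : LatticeRep G), TwistSectorLabellingAt π ρH r

/-- **S2 = SPLIT of crux 16405 (shared; landed at `|ker π| = 2`, vector `r`)**: a centre-sensitive positive-type
splitting weight with label noise `e^{−cβ}` exists at every cover datum for all large `β`. -/
def SplitAll : Prop :=
  ∀ (G : Type) [Group G] [TopologicalSpace G] [IsTopologicalGroup G] [CompactSpace G] [MeasurableSpace G]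
    [BorelSpace G], IsCompactSimpleLieGroup G → ∀ (H : Type) [Group H] [TopologicalSpace H] [IsTopologicalGroup H]
    [CompactSpace H] [MeasurableSpace H] [BorelSpace H], IsCompactSimpleLieGroup H → SimplyConnectedSpace H →
    ∀ (π : H →* G), Continuous π → Function.Surjective π → π.ker ≤ Subgroup.center H → (π.ker : Set H).Finite →
    π.ker ≠ ⊥ → ∀ (ρH : LatticeRep H) (r : LatticeRep G), TwistCentreSplittingAt π ρH r

/-! ### rev 8: `SplitVanishing` (S2ᵛ), `EquiUnits` (S3) and `EBlindUnitsV` (S4ᵛ) are LANDED VERBATIM in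
### `Theorems/BalabanLadderIRcofEquipartitionSeamKernelDefs.lean` (p687323; same namespace, same names) and imported — no copy kept here;
### S3 and S4ᵛ are THEOREMS below (bridges B1 ∕ B2 from the four kernel-currency stubs S3ʷ ∕ T ∕ D ∕ N of that file's `KernelCurrency` namespace). -/

/-- **S5ᵛ PSC in units on a cofinal set (wall 1 per sector; N_cof constant shape; rev 4: vanishing-noise split)**:
given the floors, an interface labelling family, splitting weights with noise `e^{−c(β)β} → 0` and unit equipartition,
per-sector clustering holds in the units `au` on a cofinal set of couplings with constants uniform over the set. -/
def PscUnitsCofV : Prop :=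
  ∀ (G : Type) [Group G] [TopologicalSpace G] [IsTopologicalGroup G] [CompactSpace G] [MeasurableSpace G]
    [BorelSpace G], IsCompactSimpleLieGroup G → ∀ (H : Type) [Group H] [TopologicalSpace H] [IsTopologicalGroup H]
    [CompactSpace H] [MeasurableSpace H] [BorelSpace H], IsCompactSimpleLieGroup H → SimplyConnectedSpace H →
    ∀ (π : H →* G), Continuous π → Function.Surjective π → π.ker ≤ Subgroup.center H → (π.ker : Set H).Finite →
    π.ker ≠ ⊥ → ∀ (ρH : LatticeRep H) (r : LatticeRep G) (au : ℝ → ℝ), (∀ β, 0 < au β) →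
    Tendsto au atTop (𝓝 0) → LowerBounds G r au → ∀ (a : ℝ) (cls : Labelling π),
    (∀ S : ℕ, TwistSectorInterface π ρH r a S (cls S)) → ∀ c : ℝ → ℝ, Tendsto (fun β => c β * β) atTop atTop →
    ∀ β_s : ℝ, (∀ β : ℝ, β_s ≤ β → ∃ w : H → ℝ, TwistSplitWeight π ρH r (c β) β w) → ∀ (β_e : ℝ) (S_e : ℝ → ℕ),
    (∀ β : ℝ, β_e ≤ β → EquiUnitOn π r β cls (S_e β)) →
      ∃ Bset : Set ℝ, (∀ x : ℝ, ∃ β ∈ Bset, x ≤ β) ∧ ∃ (c_p β_p : ℝ) (S_p : ℝ → ℕ), 0 < c_p ∧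
        ∀ A B : YMSpecies G, ∃ C : ℝ, ∀ β ∈ Bset, β_p ≤ β → PscUnitOn π r β cls (S_p β) A B C (c_p * au β)

/-- **S6 bad rarity at rate ≥ 1 (support; per-β form landed as `torusBadEventRare`)**: for an interface labelling
family at badness `a > 0` there are `β_c`, a constant `C` uniform in `β` and thresholds `S_c(β)` with
`BadUnitOn π r β cls (S_c β) C` for all `β ≥ β_c`. -/
def BadRareUnits : Prop :=
  ∀ (G : Type) [Group G] [TopologicalSpace G] [IsTopologicalGroup G] [CompactSpace G] [MeasurableSpace G]
    [BorelSpace G], IsCompactSimpleLieGroup G → ∀ (H : Type) [Group H] [TopologicalSpace H] [IsTopologicalGroup H]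
    [CompactSpace H] [MeasurableSpace H] [BorelSpace H], IsCompactSimpleLieGroup H → SimplyConnectedSpace H →
    ∀ (π : H →* G), Continuous π → Function.Surjective π → π.ker ≤ Subgroup.center H → (π.ker : Set H).Finite →
    π.ker ≠ ⊥ → ∀ (ρH : LatticeRep H) (r : LatticeRep G) (a : ℝ) (cls : Labelling π),
    (∀ S : ℕ, TwistSectorInterface π ρH r a S (cls S)) → 0 < a →
      ∃ (β_c C : ℝ) (S_c : ℝ → ℕ), ∀ β : ℝ, β_c ≤ β → BadUnitOn π r β cls (S_c β) C

/-- **S7 MIX in units (routine re-assembly of the landed `mix_core` with thresholds)**: bad rarity at rate 1 +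
per-sector clustering at rate `c_p·au(β)` on a cofinal set + unit equipartition + unit blindness, all with constants
uniform in `β` and thresholds `S(β)`, give `CoverGapCof π r au` (rate `min (c_p au β) (min 2 1) = c_p au β` for
`β` large since `au → 0`; threshold the maximum of the four). -/
def MixUnits : Prop :=
  ∀ (G : Type) [Group G] [TopologicalSpace G] [IsTopologicalGroup G] [CompactSpace G] [MeasurableSpace G]
    [BorelSpace G], IsCompactSimpleLieGroup G → ∀ (H : Type) [Group H] [TopologicalSpace H] [IsTopologicalGroup H]
    [CompactSpace H] [MeasurableSpace H] [BorelSpace H], IsCompactSimpleLieGroup H → SimplyConnectedSpace H →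
    ∀ (π : H →* G), Continuous π → Function.Surjective π → π.ker ≤ Subgroup.center H → (π.ker : Set H).Finite →
    π.ker ≠ ⊥ → ∀ (ρH : LatticeRep H) (r : LatticeRep G) (au : ℝ → ℝ), (∀ β, 0 < au β) →
    Tendsto au atTop (𝓝 0) → ∀ (a : ℝ) (cls : Labelling π), (∀ S : ℕ, TwistSectorInterface π ρH r a S (cls S)) →
    (∃ (β_c C : ℝ) (S_c : ℝ → ℕ), ∀ β : ℝ, β_c ≤ β → BadUnitOn π r β cls (S_c β) C) →
    (∃ Bset : Set ℝ, (∀ x : ℝ, ∃ β ∈ Bset, x ≤ β) ∧ ∃ (c_p β_p : ℝ) (S_p : ℝ → ℕ), 0 < c_p ∧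
      ∀ A B : YMSpecies G, ∃ C : ℝ, ∀ β ∈ Bset, β_p ≤ β → PscUnitOn π r β cls (S_p β) A B C (c_p * au β)) →
    (∃ (β_e : ℝ) (S_e : ℝ → ℕ), ∀ β : ℝ, β_e ≤ β → EquiUnitOn π r β cls (S_e β)) →
    (∃ (β_b : ℝ) (S_b : ℝ → ℕ), ∀ A : YMSpecies G, ∃ C : ℝ, ∀ β : ℝ, β_b ≤ β →
      EBlindUnitOn π r β cls (S_b β) A C) →
      CoverGapCof π r au

/-- **The H-side target**: the cover theory clusters in every admissible unit on a cofinal set, at every datum. -/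
def CoverGapCofAll : Prop :=
  ∀ (G : Type) [Group G] [TopologicalSpace G] [IsTopologicalGroup G] [CompactSpace G] [MeasurableSpace G]
    [BorelSpace G], IsCompactSimpleLieGroup G → ∀ (H : Type) [Group H] [TopologicalSpace H] [IsTopologicalGroup H]
    [CompactSpace H] [MeasurableSpace H] [BorelSpace H], IsCompactSimpleLieGroup H → SimplyConnectedSpace H →
    ∀ (π : H →* G), Continuous π → Function.Surjective π → π.ker ≤ Subgroup.center H → (π.ker : Set H).Finite →
    π.ker ≠ ⊥ → ∀ (ρH : LatticeRep H) (r : LatticeRep G) (au : ℝ → ℝ), (∀ β, 0 < au β) →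
    Tendsto au atTop (𝓝 0) → LowerBounds G r au → CoverGapCof π r au

/-! ## §3 Registered stubs (rev 10: FIVE — S1, S3ʷ, T, N, S5ᵛ — the ONLY `sorry`s of this file; L, D, S2ᵛ, S3, S4ᵛ, S6, S7 are theorems) -/

/-- **stub S1 (STRUCT-EXIST, shared with crux 16405).** -/
theorem stub_struct : StructAll := by
  sorry

/-- **S2ᵛ DISCHARGED BY NAME (rev 5)**: the full text of `SplitVanishing` is the landed
`SchurFejer.splitVanishing_text` (`Theorems/BalabanLadderIRcofSchurFejerFiniteCentralKer.lean`: split windows for EVERY finite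
central kernel and every faithful `ρH` — joint spectral amplitudes, finite-abelian duality, product Fejér windows). No `sorry`. -/
theorem splitVanishing_holds : SplitVanishing :=
  SchurFejer.splitVanishing_text

/-- **stub S3ʷ (EQUI ON THE WINDOW of the split-weight cover theory; FLOOR-FREE; ⊇ S3 — LOCATED-HEAVY, 't Hooft window).** -/
theorem stub_equiWindowV : KernelCurrency.EquiWindowV := by
  sorry

/-- **stub T (VACUUM thermal slack `growthRate^ϱ·Z(2S+1−ϱ) ≤ C_T·Z(2S+1)`, one `C_T` for `β ≥ β_T` — LOCATED-HEAVY, UV-flavoured).** -/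
theorem stub_vacuumSlackV : KernelCurrency.VacuumSlackV := by
  sorry

/-- **L DISCHARGED BY NAME (rev 10)**: the SLICE REALISATION of the `w`-theory (the electric family `secZ π w (withEl π z₀ e) S (M+2)`
is the `T e`-twisted cyclic trace of the `(M+2)`-nd power of ONE bounded symmetric positive-type slice kernel `K` on a probability space
with a measure-preserving `K`-invariant `(ker π)³`-action, and every species `A` of temporal thickness `thick A` with `4·thick A ≤ 2S+1` enters
`secW` as a block `Bk`, `|Bk| ≤ nrm A · pathK μ K (thick A − 1)`) is the LANDED theorem `SliceKernel.sliceRealisationV_holds`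
(`Theorems/BalabanLadderIRcofEquipartitionSeamSliceRealisation.lean` p703079, helpers p702331 ∕ p702622 ∕ p702705; text = `Lines/equipartition_seam_SliceRealisation.lean` rev 1 0079346b2e66 of this ideator: `K = sandKernel Prod.fst shift w √magW`
on one time slice, (Z) from `zPackage_of_twistSplitWeight` + `SpectralDict.complexPosType_of_real`, (W) from `blockKernel` ∕
`abs_blockKernel_le_pathK` ∕ `secW_withEl_eq_blockChain_of`).  No `sorry`. -/
theorem sliceRealisationV_holds : SpectralDict.SliceRealisationV :=
  SliceKernel.sliceRealisationV_holds

/-- **D DISCHARGED (rev 9 modulo L; rev 10 OUTRIGHT, L landed)**: `SpectralDictV` (joint eigen-datum of the three electric twists + species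
coefficients) from the slice realisation L by the landed `SpectralDict.spectralDictV_of_sliceRealisationV`
(`Theorems/BalabanLadderIRcofEquipartitionSeamSpectralDict.lean` ← `…Clauses` ← `…KernelCalc` ← `…Trace` ← `…Joint`, LEAD ab-p1 g8
p693769 ∕ p694553 ∕ p694920 ∕ p696009 ∕ p696729: complex-L² joint diagonalisation, twisted trace formula, species sandwich). No `sorry` of its own. -/
theorem spectralDictV_holds : KernelCurrency.SpectralDictV :=
  SpectralDict.spectralDictV_of_sliceRealisationV sliceRealisationV_holds

/-- **stub N (LABEL NOISE: interface label classes vs canonical sectors, per magnetic family — LOCATED-HEAVY, defect-gas dictionary).** -/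
theorem stub_labelNoiseV : KernelCurrency.LabelNoiseV := by
  sorry

/-- **S3 DISCHARGED (rev 8)**: `EquiUnits` from S3ʷ + N + S2ᵛ by bridge B1 `KernelBridges.equiUnits_of_window`. No `sorry` of its own. -/
theorem equiUnits_holds : EquiUnits :=
  KernelBridges.equiUnits_of_window stub_equiWindowV stub_labelNoiseV splitVanishing_holds

/-- **S4ᵛ DISCHARGED (rev 8; rev 9: D via L; rev 10: L landed)**: `EBlindUnitsV` from S3ʷ + T + D + N by bridge B2 `KernelBridges.eblindUnitsV_of_peeling`. No `sorry` of its own. -/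
theorem eblindUnitsV_holds : EBlindUnitsV :=
  KernelBridges.eblindUnitsV_of_peeling stub_equiWindowV stub_vacuumSlackV spectralDictV_holds stub_labelNoiseV

/-- **stub S5ᵛ (PSC in units on a cofinal set; wall 1 per sector; vanishing-noise split).** -/
theorem stub_pscUnitsCofV : PscUnitsCofV := by
  sorry

/-- **S6 DISCHARGED BY NAME (rev 7)**: the full text of `BadRareUnits` is the landed `BadRare.badRareUnits_text`
(`Theorems/BalabanLadderIRcofEquipartitionSeamBadRare.lean`: the β-TRACKED torus Peierls bound — each plaquette of an injective
spanning bad chain costs `e^{−c₀β}` (`largeFieldSparse_explicit`), so for `14406·e^{−c₀β} ≤ e^{−50}` the bad event has mass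
`≤ C e^{−S}` with ONE constant `C`; cover transport; clause X0). No `sorry`. -/
theorem badRareUnits_holds : BadRareUnits :=
  BadRare.badRareUnits_text

/-- **S7 DISCHARGED BY NAME (rev 6)**: the full text of `MixUnits` is the landed `Mix.mixUnits_text`
(`Theorems/BalabanLadderIRcofEquipartitionSeamMixUnits.lean`: crux 16405's per-torus mixture argument re-run above the thresholds
with β-uniform constants). No `sorry`. -/
theorem mixUnits_holds : MixUnits :=
  Mix.mixUnits_text

/-! ## §4 Compositions (PROVED) -/

/-- **Bridge (PROVED): crux 16405's SPLIT (fixed noise rate `e^{−cβ}`, `c > 0`) gives the vanishing-noise split S2ᵛ**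
(constant rate function; `c·β → ∞`).  So `centreSplitting_of_kerOrderTwo` and any future proof of 16405's SPLIT feed
this line unchanged. -/
theorem splitVanishing_of_splitAll (h : SplitAll) : SplitVanishing := by
  intro G _ _ _ _ _ _ hG H _ _ _ _ _ _ hH hsc π hπc hπs hker hfin hnt ρH r
  obtain ⟨c, hc, β_s, hsplit⟩ := h G hG H hH hsc π hπc hπs hker hfin hnt ρH r
  exact ⟨fun _ => c, Tendsto.const_mul_atTop hc tendsto_id, β_s, hsplit⟩

/-- **H-side composition (pure application of the seven statements).** -/
theorem coverGapCofAll_of (h1 : StructAll) (h2 : SplitVanishing) (h3 : EquiUnits) (h4 : EBlindUnitsV)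
    (h5 : PscUnitsCofV) (h6 : BadRareUnits) (h7 : MixUnits) : CoverGapCofAll := by
  intro G _ _ _ _ _ _ hG H _ _ _ _ _ _ hH hsc π hπc hπs hker hfin hnt ρH r au hpos h0 hLB
  obtain ⟨a, ha, cls, hI⟩ := h1 G hG H hH hsc π hπc hπs hker hfin hnt ρH r
  obtain ⟨c, hc, β_s, hsplit⟩ := h2 G hG H hH hsc π hπc hπs hker hfin hnt ρH r
  obtain ⟨β_e, S_e, hE⟩ := h3 G hG H hH hsc π hπc hπs hker hfin hnt ρH r au hpos h0 hLB a cls hI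
  have hB := h4 G hG H hH hsc π hπc hπs hker hfin hnt ρH r a cls hI c hc β_s hsplit β_e S_e hE
  have hP := h5 G hG H hH hsc π hπc hπs hker hfin hnt ρH r au hpos h0 hLB a cls hI c hc β_s hsplit β_e S_e hE
  have hR := h6 G hG H hH hsc π hπc hπs hker hfin hnt ρH r a cls hI ha
  exact h7 G hG H hH hsc π hπc hπs hker hfin hnt ρH r au hpos h0 a cls hI hR hP ⟨β_e, S_e, hE⟩ hB

/-- **The same composition fed by crux 16405's SPLIT verbatim** (through the bridge). -/
theorem coverGapCofAll_of_splitAll (h1 : StructAll) (h2 : SplitAll) (h3 : EquiUnits) (h4 : EBlindUnitsV)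
    (h5 : PscUnitsCofV) (h6 : BadRareUnits) (h7 : MixUnits) : CoverGapCofAll :=
  coverGapCofAll_of h1 (splitVanishing_of_splitAll h2) h3 h4 h5 h6 h7

/-- **Cover transport (PROVED): the H-side target gives N_cof.**  Weyl's cover (LANDED
`CompactSemisimpleUniversalCover_holds` through `stub_universalCover_of_cover`), a faithful `ρH` from
`IsCompactSimpleLieGroup H`, and the LANDED pullback identity `stub_corrPullbackCover` (each pulled-back correlation
of the `(H, r∘π)` theory IS the `G`-theory correlation; `G` second countable through the faithful `r`). -/
theorem irnscCof_of_coverGapCofAll (h : CoverGapCofAll) : IRnscCof := by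
  intro G _ _ _ _ hG hnsc
  letI : MeasurableSpace G := borel G
  haveI : BorelSpace G := ⟨rfl⟩
  intro r au hpos h0 hLB
  obtain ⟨H, _, _, _, _, _, _, π, hH, hsc, hπc, hπs, hker, hfin, hnt⟩ :=
    stub_universalCover_of_cover
      Literature.RepresentationTheory.CompactGroups.CompactSemisimpleUniversalCover_holds G hG hnsc
  obtain ⟨ρH⟩ := hH.2
  obtain ⟨Bset, hcof, c₁, β₂, S₁, hc₁, hAB⟩ :=
    h G hG H hH hsc π hπc hπs hker hfin hnt ρH r au hpos h0 hLB
  refine ⟨Bset, hcof, c₁, β₂, S₁, hc₁, fun A B => ?_⟩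
  obtain ⟨C, hC⟩ := hAB A B
  refine ⟨C, fun β hβ hβ₂ S n hS hn => ?_⟩
  haveI : SecondCountableTopology G :=
    (r.continuous.isClosedEmbedding r.injective).isEmbedding.secondCountableTopology
  rw [← stub_corrPullbackCover G H π hπc hπs r.N r.ρ r.continuous β (2 * S + 1) A.F B.F A.measurable
    B.measurable n]
  exact hC β hβ hβ₂ S n hS hn

/-- **N_cof from the SIX registered stubs** (rev 8: S2ᵛ, S3, S4ᵛ, S6, S7 are theorems; `sorry` only through `stub_*`). -/
theorem irnscCof_of_stubs : IRnscCof :=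
  irnscCof_of_coverGapCofAll (coverGapCofAll_of stub_struct splitVanishing_holds equiUnits_holds eblindUnitsV_holds
    stub_pscUnitsCofV badRareUnits_holds mixUnits_holds)

/-- **The route decl BY NAME through the slot of record** (`PinnedCofinalBill.IRcof_of`, PROVED bill
`PXcof(1∕24) → N_cof → IRcof`): PXcof side = the lead's registered `stub_pinnedExitsCofinal` (untouched), N_cof side =
this line. -/
theorem IRcof_of_stubs : Summit.QuantumFields.YangMills.Theses.BalabanLadder.IRcof :=
  PinnedCofinalBill.IRcof_of PinnedCofinalBill.stub_pinnedExitsCofinal irnscCof_of_stubs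


/-! ## §5 The engine in OPERATOR form — LANDED (p664144, `Theorems/BalabanLadderIRcofEquipartitionSeamOperatorForm.lean`,
## ns `…Theorems.NonSimplyConnectedLatticeGap`; extracted verbatim from rev 2 of this file by the custody LEAD ym-ir-line-ab-p1 g7,
## crit-3 GATE WORD «LAND IT» 20:13:14Z): cited BY NAME, no copy kept here (rev 3).

* `norm_trace_mul_le_of_quadForm` — `B ⪰ 0`, numerical radius of `K` `≤ a` ⇒ `‖tr (B K)‖ ≤ a · Re tr B`;
* `quadForm_of_loewner` — Loewner `−a ≤ A ≤ a` ⇒ the quadratic-form bound;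
* `centreFourier_traceBlindness_quadForm` — the engine (p164278) for multi-slice ∕ non-Hermitian species.
All three are in scope through `open Summit.QuantumFields.YangMills.Theorems.NonSimplyConnectedLatticeGap` (file header). -/


/-! ## §6  Typed hook to row 39's token — LANDED (p666431, `Theorems/BalabanLadderIRcofEquipartitionSeamCodeHook.lean`,
## ns `…Theorems.NonSimplyConnectedLatticeGap`; §6 of rev 3 landed verbatim by the custody LEAD ym-ir-line-ab-p1 g7 on crit-3's GATE
## WORD 20:22:32Z; rev 4 cites BY NAME, no copy kept here)

* `Literature.MathematicalPhysics.QuantumLattice.norm_star_dotProduct_mulVec_le` (tree, `TraceInequalitiesProofs`) — operator norm ⇒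
  numerical radius: `‖star v ⬝ᵥ (K *ᵥ v)‖ ≤ ‖K‖ · Re (star v ⬝ᵥ v)` for the ℓ²-operator norm (rev 3's `quadForm_of_l2OpNorm` restated it;
  replaced by the tree name at landing, `dedup.landed`);
* `norm_trace_mul_le_opNorm` — `B ⪰ 0` ⇒ `‖tr (B K)‖ ≤ ‖K‖ · Re tr B`;
* `posSemidef_sub_eigenProj` — `B ⪰ 0`, `B e = θ e`, `⟨e, e⟩ = 1` ⇒ `B − θ|e⟩⟨e| ⪰ 0`;
* `norm_trace_mul_sub_eigen_le` (+ `_opNorm`) — `‖tr(B K) − θ ⟨e, K e⟩‖ ≤ a · (Re tr B − θ)`; `eigen_le_trace_re` — `θ ≤ Re tr B`;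
* `centreFourier_traceBlindness_opNorm` — the engine p164278 with NO hypothesis on the observable.
Dictionary to `FluxCodeBlindness.LightCodeModel` (row 39, `Theorems/BalabanLadderIRLightCodeDefs.lean`): `B ↦ P_k 𝕋^w`
(PSD by `posSemidef_proj_mul_pow`), `e ↦ e k`, `θ ↦ θ_k^w`, `K ↦` the slab operator of `A∘`, `Re tr B − θ ↦` the
sector-`k` summand of the cold pressure.  All in scope through `open Summit.QuantumFields.YangMills.Theorems.NonSimplyConnectedLatticeGap`. -/

open scoped ComplexOrder in
/-- Sanity (nothing asserted): the landed §6 names are in scope with the expected shapes. -/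
example {n : Type} [Fintype n] [DecidableEq n] {B : Matrix n n ℂ} (hB : B.PosSemidef) {e : n → ℂ} {θ : ℝ}
    (he : B.mulVec e = (θ : ℂ) • e) (hunit : star e ⬝ᵥ e = 1) : θ ≤ B.trace.re :=
  eigen_le_trace_re hB he hunit


/-! ## §7 (rev 4, g4) — S2 for `|ker π| = N ≥ 3`: the two located splitting-weight constructions (record; nothing asserted)

Datum: cyclic kernel `Γ = ker π = ⟨k₀⟩ ≅ ℤ_N` acting through `ρH` by scalars `ρH(k₀) = ω • 1`, `ω` a primitive `N`-th root of
unity (Schur; e.g. `SU(N) → SU(N)/ℤ_d`, `ρH` fundamental), blind weight `E(h) = exp(β Re tr r(π h))` (ANY faithful `r`),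
`u(h) := tr ρH(h) / dim ρH` (`|u| ≤ 1`, `u(k₀ h) = ω u(h)`, positive type, `u(h⁻¹) = conj (u h)`).  Write `u^{(n)} := u^n`
(`n ≥ 0`), `conj(u)^{|n|}` (`n < 0`).

(A) SCHUR–FEJÉR WINDOW (vanishing noise `≍ 1/β`; every clause elementary — the located prover-sized helper for S2ᵛ).
`W_F(h) := N^{−2} Σ_{j,k=0}^{N−1} u(h)^{(j−k)}`, `w := E · W_F`.  Then: (i) EXACT: `Σ_{k∈Γ} W_F(k h) = 1` (the only
`Γ`-blind term of the double sum is `j = k`, since `Σ_{m<N} ω^{mn} = 0` for `0 < |n| < N`), so `Σ_k w(kh) = E(h)`;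
(ii) POSITIVE TYPE: `u^{(n)}` is of positive type (Schur products of `u`, `conj u`), coefficients `(N − |n|)/N² ≥ 0`, and
`E` is of positive type (`exp` of the blind character), so `w = E·W_F` is (Schur); (iii) `W_F ≥ 0` on ALL of `H` by the
sum-of-squares identity (Cholesky factor of the AR(1) ∕ Poisson–Toeplitz matrix `(u^{(j−k)})_{jk}`), valid for `|u| ≤ 1`:
`Σ_{j,k<N} u^{(j−k)} = |Σ_{j<N} u^j|² + (1 − |u|²) Σ_{m=1}^{N−1} |Σ_{l<N−m} u^l|²`; (iv) `W_F(1) = 1`, `W_F(k) = 0` for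
`k ∈ Γ ∖ {1}` (Fejér zeros), `1 − W_F(e^{iA}) = κ_N ‖A‖² + O(‖A‖³)` with `κ_N = (N²−1)/(6N²)` (checked numerically,
N = 2…6); continuity, centrality, symmetry are those of `u`; (v) NOISE: `∫_{cell 1}(E − w) / ∫ w = ∫_{cell 1} E(1 − W_F) / ∫ E W_F → 0`
as `β → ∞` because `E dHaar / ∫E ⇒ N^{−1} Σ_{k∈Γ} δ_k` (faithful `r`: `Re tr r(π h)` is maximal exactly on `Γ`, and the `Γ`-symmetry
of `E` equalises the local masses) while `1 − W_F` vanishes at `1 ∈ interior(cell 1)` and `W_F(k) = 0` off it — quantitatively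
`≍ κ_N E_β‖A‖² ≍ 1/β`, i.e. `c(β) = (log β − O(1))/β`, `c(β)·β → ∞` ✓.  This is EXACTLY what S2ᵛ asks; it does NOT give 16405's
fixed-rate SPLIT (the flat-top obstruction: for a positive-type window `1 − W(h²) ≤ 4(1 − W(h))`, so no window is `e^{−cβ}`-flat
on the `β^{−1/2}`-bulk — pool-p3 g15's sizing note (a), 2026-08-28T20:39:41Z, independently).  For `|Γ| = 2` it is
`w = E(1 + u)/2`.  Non-cyclic `Γ = ℤ₂ × ℤ₂` (`Spin(4k) → PSO(4k)`, `ρH` reducible): `W_F := |Γ|^{−2} Π_i Σ_{j,k<2} φ_i^{(j−k)}`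
with `φ_i` normalised constituent characters separating `Γ` — same algebra.

(B) SECTOR HUBBARD–STRATONOVICH WEIGHT (fixed-rate noise `e^{−cβ}`, i.e. 16405's SPLIT as typed; adjoint-type datum
`Re tr r(π h) = |tr ρH h|² − 1`).  `w(h) := e^{−β} E_ξ[𝟙_{|arg ξ| < π/N} exp(2√β Re(conj ξ · tr ρH h))]`, `ξ` standard complex
Gaussian: EXACT (rotating `ξ` by `ω^k` realises `h ↦ k₀^k h`; the `N` sectors tile `ℂ`), `≥ 0`, continuous, central, symmetric,
noise `e^{−cβ}` (a misaligned block climbs only to `|tr| cos(π/N)`).  POSITIVE TYPE ⇔ for every charged irrep `σ` of `SU(N)`,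
with `λ` its dominant lift of charge `a = |λ| ∈ {1,…,N−1}` and `F_β(μ) := ∫_0^∞ 2ρ e^{−ρ²} det[I_{μ_i − i + j}(2√β ρ)]_{i,j≤N} dρ ≥ 0`
(Gaussian radial average of the `U(N)` Bessel–Toeplitz character coefficients):
`(U''_N)  Σ_{m∈ℤ} (−1)^m F_β(λ + m·𝟙)/(a + N m) ≥ 0`,
for which it SUFFICES that `m ↦ F_β(λ + m𝟙)/(a + Nm)` (`m ≥ 0`) and `n ↦ F_β(λ − n𝟙)/(Nn − a)` (`n ≥ 1`) are non-increasing
(two alternating series with positive leading terms; the blind normalisation is the identity `Σ_m (−1)^m/(a + Nm) = π/(N sin(πa/N))`).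
NUMERICS (this seat, pure Python, floats): N = 3, β ∈ {1/4, 1/2, 1, 2, 4, 8, 16}, all 150 charged `σ` with Dynkin labels `≤ 14`:
monotonicity holds with 0 violations and `Σ(−1)^m… / Σ|…| ≥ 0.45`; N = 3, 4 POINTWISE in `ρ` (before the radial average) it FAILS
at small `ρ` (e.g. N = 3, ρ = 0.3, λ = (3,2,−4); N = 4, ρ = 1, λ = (2,2,2,−4)) — the Gaussian radial average is essential, and
«termwise» positivity of the sector's mixed moments `sin((a−b)π/N)/(a−b)` (pool-p3 (b)) is indeed false while `(U''_N)` holds.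
`(U''_N)` is the located FIRST LEMMA for 16405's SPLIT at `|Γ| ≥ 3` (classical analysis of Bessel–Toeplitz determinants; open).

Neither (A) nor (B) is asserted in Lean here; (A) is offered as the next helper (`centreSplittingVanishing_of_kerCyclic`,
shape of `centreSplitting_of_kerOrderTwo` with `ρH(k₀) = ω • 1`, conclusion the S2ᵛ body), (B) ∕ `(U''_N)` as a crux idea. -/



end Summit.QuantumFields.YangMills.Cruxes.IRcof.EquipartitionSeam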